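import Summits.BirchSwinnertonDyer.BirchSwinnertonDyer.Theorems.PrintCf2SplitBadTwoLocalGroupsBridge
import Mathlib.GroupTheory.DoubleCoset
import HarnessLib

/-!
# Crux `PrintCf2.SplitBadTwoRankOneOfFacts` (stmt-BirchSwinnertonDyer-20368), S3n′-FACT-FREE road (a), H¹-transport FILE 1:
# THE PLACES OF THE LAYER FIELD `L` ABOVE `w` ≃ THE DOUBLE COSETS `D_w \ Γ_K / Gal(K̄/L)`, WITH THE LOCAL GROUPS MATCHED

Cell `bsd-print-cf2`, WIDTH seat `bsd-line-cf2-p1-w6` g6 (prover-bsd-line-cf2-p1-w6-g6-0); `--supports stmt-BirchSwinnertonDyer-20368` (helper,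
Theses-free). HONEST FRAMING: Galois-theoretic bookkeeping; nothing here closes the crux or a registered stub; BSD is not proved by any of this;
no summit statement is proved by this seat. No definition, no named fact, no instance, no `sorry`.

ROLE (-w7 g6 STATUS 06:26:09Z, my 06:31:07Z spec): the line's (LSₙ) targets (-w4 g12 `UpperBaseLift.locSurj_of_layers`, -w3 g13 `LocSurjLimit`) are
indexed by `q : DoubleCoset.Quotient ↑(decomp w) ↑U`, `U = Gal(K̄/L)` the layer subgroup, and read on `decompIn U w = U ⊓ D_w` after `conjH1 U M q.out`
(i.e. on `U ⊓ σ⁻¹·D_w·σ`, `σ = q.out`); the layer field's own Poitou–Tate statement (-w7 g6 `KummerProNull.exists_selmer_sub_localMap_mem_of_trivial`)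
indexes its targets by the places `w' ∣ w` of `L`. This file proves that the two index sets are in canonical bijection and that the local groups
correspond, for ANY normal finite subextension `L ⊆ K̄` of a number field `K` and ANY finite place `w`:

* **`exists_equiv_doubleCoset_extension`** — `∃ f : D_w \ Γ_K / U ≃ w.Extension (𝓞 L)` (`U = galFixing K L`, `res = absGaloisRestrict K L`) with
  (P1) for every `w'` there is `σ` with `f [σ] = w'` and EXACTLY `U ⊓ σ⁻¹·D_w·σ = res(D_{w'}(L))`, `U ⊓ σ⁻¹·I_w·σ = res(I_{w'}(L))`;
  (P2) for every `σ` there is `τ ∈ Γ_L` with `U ⊓ σ⁻¹·D_w·σ = res(τ·D_{f[σ]}(L)·τ⁻¹)` and `U ⊓ σ⁻¹·I_w·σ = res(τ·I_{f[σ]}(L)·τ⁻¹)`.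
  (`f [σ]` = the place of `L` under the prime `σ⁻¹𝔓₀` of `\bar ℤ_K ≅ \bar ℤ_L`, `𝔓₀ = adicCompletionPrime K w`; well defined and injective because
  `Γ_L = Gal(K̄/L)` is transitive on the primes of `L̄` above a prime of `L` and `D_w = Stab(𝔓₀)`; surjective by transitivity of `Γ_K` above `w`.)
  Neukirch I §9 p. 54: «the primes of `L` above `𝔭` correspond to the double cosets `H \ G / G_𝔓`».
* For the layers of a `ℤ_p`-line take `L := κ.layer n` (tree: `galFixing_layer : galFixing K (κ.layer n) = κ.layerSubgroup n`).

References: J. Neukirch, *Algebraic Number Theory* (1999) I §9 (9.1)–(9.6), p. 54; II §9 (9.6). beyond-print theorem: no (folklore).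
-/

set_option linter.dupNamespace false

noncomputable section

open scoped NumberField Pointwise
open IsDedekindDomain Field
open Literature.NumberTheory.GaloisRepresentations Literature.NumberTheory.GaloisRepresentations.LocalWeilDatum
open Literature.NumberTheory.EllipticCurves.GreenbergSelmer
open Summit.BirchSwinnertonDyer.BirchSwinnertonDyer.Theorems.PrintCf2.LocalGroupsBridge

namespace Summit.BirchSwinnertonDyer.BirchSwinnertonDyer.Theorems.PrintCf2.LayerFieldPlaces

/-! ## §1. The prime of `\bar ℤ_L` over `σ⁻¹𝔓₀` and the place of `L` below it -/

section Places

variable {K : Type} [Field K] [NumberField K] (L : IntermediateField K (AlgebraicClosure K)) [NumberField L]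
  (w : HeightOneSpectrum (𝓞 K))

/-- For every `σ ∈ Γ_K` there are a prime `𝔔` of `\bar ℤ_L` with `ι⁻¹𝔔 = σ⁻¹𝔓₀` (`ι : \bar ℤ_K ≅ \bar ℤ_L`) and the place `w' ∣ w` of `L` below it.
[cite: NeukirchANT1999, Ch. I §9 Prop. (9.1)] -/
theorem exists_prime_extension (σ : absoluteGaloisGroup K) :
    ∃ (𝔔 : Ideal (absIntegers (𝓞 L) L)) (w' : w.Extension (𝓞 L)),
      𝔔.IsPrime ∧ 𝔔.comap (absIntegersMap K L) = σ⁻¹ • adicCompletionPrime K w ∧ 𝔔 ∈ w'.1.primesAbove := by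
  set 𝔓 : Ideal (absIntegers (𝓞 K) K) := σ⁻¹ • adicCompletionPrime K w with h𝔓def
  have h𝔓 : 𝔓 ∈ w.primesAbove := smul_mem_primesAbove (adicCompletionPrime_mem_primesAbove K w) σ⁻¹
  set 𝔔 : Ideal (absIntegers (𝓞 L) L) := 𝔓.comap (absIntegersEquiv K L).symm.toRingHom with h𝔔def
  have h𝔔𝔓 : 𝔔.comap (absIntegersMap K L) = 𝔓 := by
    have hcomp : (absIntegersEquiv K L).symm.toRingHom.comp (absIntegersMap K L) = RingHom.id _ :=
      RingHom.ext fun x ↦ (absIntegersEquiv K L).symm_apply_apply x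
    rw [h𝔔def, Ideal.comap_comap, hcomp, Ideal.comap_id]
  haveI : 𝔓.IsPrime := h𝔓.1
  haveI h𝔔p : 𝔔.IsPrime := Ideal.comap_isPrime _ 𝔓
  obtain ⟨w₀, hw₀, h𝔔w, -⟩ := exists_heightOneSpectrum_of_comap_absIntegersMap_mem_primesAbove (K := K) (M := L) (𝔔 := 𝔔) (h𝔔𝔓 ▸ h𝔓)
  exact ⟨𝔔, ⟨w₀, HeightOneSpectrum.ext hw₀⟩, h𝔔p, h𝔔𝔓, h𝔔w⟩

omit [NumberField K] [NumberField L] in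
/-- The prime `𝔔` of `\bar ℤ_L` with `ι⁻¹𝔔 = 𝔓` is unique (`ι` is a bijection). [folklore] -/
theorem eq_of_comap_absIntegersMap_eq {𝔔₁ 𝔔₂ : Ideal (absIntegers (𝓞 L) L)}
    (h : 𝔔₁.comap (absIntegersMap K L) = 𝔔₂.comap (absIntegersMap K L)) : 𝔔₁ = 𝔔₂ :=
  Ideal.comap_injective_of_surjective _ (absIntegersMap_surjective K L) h

/-- The place below a prime is unique: `𝔔 ∈ w₁'.primesAbove ∧ 𝔔 ∈ w₂'.primesAbove ⟹ w₁' = w₂'`. [folklore] -/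
theorem extension_eq_of_mem_primesAbove {𝔔 : Ideal (absIntegers (𝓞 L) L)} {w₁' w₂' : w.Extension (𝓞 L)}
    (h₁ : 𝔔 ∈ w₁'.1.primesAbove) (h₂ : 𝔔 ∈ w₂'.1.primesAbove) : w₁' = w₂' := by
  apply Subtype.ext
  apply HeightOneSpectrum.ext
  rw [h₁.2.over, h₂.2.over]

omit [NumberField K] in
/-- Two primes of `\bar ℤ_L` above the same place `w'` of `L` are `Γ_L`-conjugate, read in `\bar ℤ_K`: `res γ • ι⁻¹𝔔₁ = ι⁻¹𝔔₂`.
[cite: NeukirchANT1999, Ch. I §9 Prop. (9.1)] -/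
theorem exists_absGaloisRestrict_smul_comap_eq {w' : HeightOneSpectrum (𝓞 L)} {𝔔₁ 𝔔₂ : Ideal (absIntegers (𝓞 L) L)}
    (h₁ : 𝔔₁ ∈ w'.primesAbove) (h₂ : 𝔔₂ ∈ w'.primesAbove) :
    ∃ γ : absoluteGaloisGroup L, absGaloisRestrict K L γ • 𝔔₁.comap (absIntegersMap K L) = 𝔔₂.comap (absIntegersMap K L) := by
  obtain ⟨γ, hγ⟩ := HeightOneSpectrum.exists_smul_eq_of_mem_primesAbove_holds h₁ h₂
  exact ⟨γ, by rw [← comap_absIntegersMap_smul, hγ]⟩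

/-! ## §2. The bijection `D_w \ Γ_K / Gal(K̄/L) ≃ {w' ∣ w}` with matched local groups -/

variable [Normal K L]

set_option synthInstance.maxHeartbeats 160000 in
-- the pointwise `Γ_K`-action on the ideals of `\bar ℤ_K` is found slowly through the non-reducible `absoluteGaloisGroup`
-- (same allowance as `DecompositionGroupNested`)
set_option maxHeartbeats 400000 in
/-- **THE PLACES OF `L` ABOVE `w` ARE THE DOUBLE COSETS `D_w \ Γ_K / Gal(K̄/L)`, WITH THE LOCAL GROUPS MATCHED.** For a normal finite
`L ⊆ K̄` over the number field `K` (`U = galFixing K L`, `res = absGaloisRestrict K L`) and a finite place `w` of `K` there is a bijection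
`f : D_w \ Γ_K / U ≃ w.Extension (𝓞 L)` such that (P1) every `w'` is `f [σ]` for some `σ` with `U ⊓ σ⁻¹D_wσ = res(D_{w'}(L))` and
`U ⊓ σ⁻¹I_wσ = res(I_{w'}(L))` EXACTLY, and (P2) for every `σ`, `U ⊓ σ⁻¹D_wσ = res(τ·D_{f[σ]}(L)·τ⁻¹)`, `U ⊓ σ⁻¹I_wσ = res(τ·I_{f[σ]}(L)·τ⁻¹)` for
some `τ ∈ Γ_L`. [cite: NeukirchANT1999, Ch. I §9 p. 54] [cite: NeukirchANT1999, Ch. II §9 Prop. (9.6)] -/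
theorem exists_equiv_doubleCoset_extension :
    ∃ f : DoubleCoset.Quotient (decomp w : Set (absoluteGaloisGroup K)) (galFixing K L) ≃ w.Extension (𝓞 L),
      (∀ w' : w.Extension (𝓞 L), ∃ σ : absoluteGaloisGroup K, f (DoubleCoset.mk (decomp w) (galFixing K L) σ) = w' ∧
          galFixing K L ⊓ MulAut.conj σ⁻¹ • decomp w = (decomp (K := L) w'.1).map (absGaloisRestrict K L).toMonoidHom ∧
          galFixing K L ⊓ MulAut.conj σ⁻¹ • inertia w = (inertia (K := L) w'.1).map (absGaloisRestrict K L).toMonoidHom) ∧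
      (∀ σ : absoluteGaloisGroup K, ∃ τ : absoluteGaloisGroup L,
          galFixing K L ⊓ MulAut.conj σ⁻¹ • decomp w =
              (MulAut.conj τ • decomp (K := L) (f (DoubleCoset.mk (decomp w) (galFixing K L) σ)).1).map
                (absGaloisRestrict K L).toMonoidHom ∧
          galFixing K L ⊓ MulAut.conj σ⁻¹ • inertia w =
              (MulAut.conj τ • inertia (K := L) (f (DoubleCoset.mk (decomp w) (galFixing K L) σ)).1).map
                (absGaloisRestrict K L).toMonoidHom) := by
  classical
  -- the place function `g : Γ_K → {w' ∣ w}` and its prime `Q σ`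
  have hex := exists_prime_extension L w
  let Q : absoluteGaloisGroup K → Ideal (absIntegers (𝓞 L) L) := fun σ ↦ (hex σ).choose
  let g : absoluteGaloisGroup K → w.Extension (𝓞 L) := fun σ ↦ (hex σ).choose_spec.choose
  have hQp : ∀ σ, (Q σ).IsPrime := fun σ ↦ (hex σ).choose_spec.choose_spec.1
  have hQ : ∀ σ, (Q σ).comap (absIntegersMap K L) = σ⁻¹ • adicCompletionPrime K w := fun σ ↦ (hex σ).choose_spec.choose_spec.2.1
  have hg : ∀ σ, Q σ ∈ (g σ).1.primesAbove := fun σ ↦ (hex σ).choose_spec.choose_spec.2.2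
  have hU : (absGaloisRestrict K L).toMonoidHom.range = galFixing K L := range_absGaloisRestrict_eq_galFixing L
  -- `g` is constant on double cosets `D_w σ U`
  have hconst : ∀ σ σ' : absoluteGaloisGroup K, DoubleCoset.setoid ↑(decomp w) ↑(galFixing K L) σ σ' → g σ = g σ' := by
    intro σ σ' h
    obtain ⟨d, hd, u, hu, rfl⟩ := DoubleCoset.rel_iff.mp h
    rw [← hU] at hu
    obtain ⟨γ, rfl⟩ := hu
    -- `d ∈ D_w` stabilises `𝔓₀`
    have hd' : d⁻¹ • adicCompletionPrime K w = adicCompletionPrime K w := by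
      apply Ideal.mem_decompositionSubgroup_iff.mp
      rw [decompositionSubgroup_adicCompletionPrime_eq_range]
      exact inv_mem hd
    -- `Q σ' = γ⁻¹ • Q σ`
    have hQ' : Q (d * σ * absGaloisRestrict K L γ) = γ⁻¹ • Q σ := by
      apply eq_of_comap_absIntegersMap_eq L
      have h1 : (d * σ * absGaloisRestrict K L γ)⁻¹ • adicCompletionPrime K w =
          (absGaloisRestrict K L γ)⁻¹ • (σ⁻¹ • (d⁻¹ • adicCompletionPrime K w)) := by
        rw [mul_inv_rev, mul_inv_rev, ← smul_smul, ← smul_smul]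
      rw [hQ, comap_absIntegersMap_smul, hQ, h1, hd', map_inv]
    refine extension_eq_of_mem_primesAbove L w (hg σ) ?_
    have h2 : γ⁻¹ • Q σ ∈ (g (d * σ * absGaloisRestrict K L γ)).1.primesAbove := hQ' ▸ hg (d * σ * absGaloisRestrict K L γ)
    have h3 : γ • (γ⁻¹ • Q σ) ∈ (g (d * σ * absGaloisRestrict K L γ)).1.primesAbove := smul_mem_primesAbove h2 γ
    rwa [smul_inv_smul] at h3
  let f₀ : DoubleCoset.Quotient (decomp w : Set (absoluteGaloisGroup K)) (galFixing K L) → w.Extension (𝓞 L) :=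
    Quotient.lift g hconst
  have hf₀ : ∀ σ, f₀ (DoubleCoset.mk (decomp w) (galFixing K L) σ) = g σ := fun σ ↦ rfl
  -- injective
  have hinj : Function.Injective f₀ := by
    intro q₁ q₂ h
    induction q₁ using Quotient.inductionOn with | h σ₁ => ?_
    induction q₂ using Quotient.inductionOn with | h σ₂ => ?_
    change g σ₁ = g σ₂ at h
    obtain ⟨γ, hγ⟩ := exists_absGaloisRestrict_smul_comap_eq (K := K) L (hg σ₁) (h ▸ hg σ₂)
    rw [hQ, hQ, ← mul_smul, eq_inv_smul_iff, ← mul_smul] at hγ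
    -- `σ₂ · res γ · σ₁⁻¹ ∈ Stab(𝔓₀) = D_w`
    have hmem : σ₂ * (absGaloisRestrict K L γ * σ₁⁻¹) ∈ decomp w := by
      change _ ∈ (absGaloisRestrict K (w.adicCompletion K)).toMonoidHom.range
      rw [← decompositionSubgroup_adicCompletionPrime_eq_range]
      exact Ideal.mem_decompositionSubgroup_iff.mpr hγ
    apply Quotient.sound
    refine DoubleCoset.rel_iff.mpr ⟨σ₂ * (absGaloisRestrict K L γ * σ₁⁻¹), hmem, (absGaloisRestrict K L γ)⁻¹, ?_, by group⟩
    rw [← hU]; exact inv_mem ⟨γ, rfl⟩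
  -- surjective, with the EXACT local groups for the chosen `σ`
  have hsurj : ∀ w' : w.Extension (𝓞 L), ∃ σ : absoluteGaloisGroup K, g σ = w' ∧
      galFixing K L ⊓ MulAut.conj σ⁻¹ • decomp w = (decomp (K := L) w'.1).map (absGaloisRestrict K L).toMonoidHom ∧
      galFixing K L ⊓ MulAut.conj σ⁻¹ • inertia w = (inertia (K := L) w'.1).map (absGaloisRestrict K L).toMonoidHom := by
    intro w'
    obtain ⟨σ₀, hσ₀⟩ := HeightOneSpectrum.exists_smul_eq_of_mem_primesAbove_holds (adicCompletionPrime_mem_primesAbove K w)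
      (comap_adicCompletionPrime_mem_primesAbove L w w')
    refine ⟨σ₀⁻¹, ?_, ?_, ?_⟩
    · -- `Q σ₀⁻¹ = 𝔓₀^L(w')`
      have hQ' : Q σ₀⁻¹ = adicCompletionPrime L w'.1 := by
        apply eq_of_comap_absIntegersMap_eq L
        rw [hQ, inv_inv, hσ₀]
      exact extension_eq_of_mem_primesAbove L w (hg _) (hQ' ▸ adicCompletionPrime_mem_primesAbove L w'.1)
    · rw [inv_inv, ← hU, ← Subgroup.map_comap_eq, conj_smul_decomp_eq_decompositionSubgroup_smul, hσ₀,
        comap_decompositionSubgroup_comap_absIntegersMap, decompositionSubgroup_adicCompletionPrime_eq_range]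
      rfl
    · rw [inv_inv, ← hU, ← Subgroup.map_comap_eq, conj_smul_inertia_eq_inertia_smul, hσ₀, comap_inertia_comap_absIntegersMap,
        inertia_adicCompletionPrime_eq_map_absInertia]
      rfl
  let f : DoubleCoset.Quotient (decomp w : Set (absoluteGaloisGroup K)) (galFixing K L) ≃ w.Extension (𝓞 L) :=
    Equiv.ofBijective f₀ ⟨hinj, fun w' ↦ by obtain ⟨σ, hσ, -⟩ := hsurj w'; exact ⟨DoubleCoset.mk _ _ σ, hσ⟩⟩
  refine ⟨f, fun w' ↦ ?_, fun σ ↦ ?_⟩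
  · obtain ⟨σ, hσ, hD, hI⟩ := hsurj w'
    exact ⟨σ, hσ, hD, hI⟩
  · -- (P2): `res⁻¹(σ⁻¹ D_w σ) = D_{Q σ} = τ D_{𝔓₀^L(g σ)} τ⁻¹`
    obtain ⟨τ, hτ⟩ := HeightOneSpectrum.exists_smul_eq_of_mem_primesAbove_holds (adicCompletionPrime_mem_primesAbove L (g σ).1) (hg σ)
    haveI := hQp σ
    refine ⟨τ, ?_, ?_⟩
    · change galFixing K L ⊓ MulAut.conj σ⁻¹ • decomp w = (MulAut.conj τ • decomp (K := L) (g σ).1).map _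
      rw [← hU, ← Subgroup.map_comap_eq, conj_smul_decomp_eq_decompositionSubgroup_smul, ← hQ σ,
        comap_decompositionSubgroup_comap_absIntegersMap, ← hτ, Ideal.decompositionSubgroup_smul,
        decompositionSubgroup_adicCompletionPrime_eq_range]
      rfl
    · change galFixing K L ⊓ MulAut.conj σ⁻¹ • inertia w = (MulAut.conj τ • inertia (K := L) (g σ).1).map _
      rw [← hU, ← Subgroup.map_comap_eq, conj_smul_inertia_eq_inertia_smul, ← hQ σ, comap_inertia_comap_absIntegersMap, ← hτ,
        ← conj_smul_inertia_eq_inertia_smul]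

end Places

end Summit.BirchSwinnertonDyer.BirchSwinnertonDyer.Theorems.PrintCf2.LayerFieldPlaces
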